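import Mathlib
import HarnessLib
import Literature.MathematicalPhysics.QuantumLattice.HubbardGrandCanonicalDensity
import Literature.MathematicalPhysics.QuantumLattice.HubbardFreeTorusGroundEnergy
import Literature.MathematicalPhysics.QuantumLattice.TorusCooperSum
import Summits.HubbardSuperconductivity.HubbardSuperconductivity.Theorems.WeakCouplingBCSWcbcsBcsConstructionDensityBracketsOfFreeCounts

/-!
# WeakCouplingBCS / crux `WcbcsBcsConstruction` — the density stays inside `(1/2, 1)` on the whole
# chemical-potential window (stub `stub_densityInsideUnitWindow`, part (T2) of line `ladder-scale-certified-chain`)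

Line `ladder-scale-certified-chain` of crux stmt-HubbardSuperconductivity-2010, registered sub-goal
`stub_densityInsideUnitWindow`. Write `N_L(U,y) = Re ω₀[hubbardTorusWith 2 L 1 U y](N)` for the tracial
grand-canonical ground-state particle number of the Hubbard torus `(ℤ/Lℤ)²` at hopping `1`, repulsion `U ≥ 0`
and chemical potential `y`, `n_L(U,y) = N_{L+1}(U,y)/(L+1)²` for the density along the sides `L + 1`, and
`torusLevelCount L E = #{k ∈ (ℤ/Lℤ)² : ε_L(k) ≤ E}` for the free level-counting function of the band
`ε_L(k) = -2(cos(2πk₁/L) + cos(2πk₂/L))`.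

**Theorem** (`stub_densityInsideUnitWindow`). IF for all large sides `L` the free level counts satisfy
`0.61·L² ≤ 2·torusLevelCount L (-23/25)` and `2·torusLevelCount L (-3/10) ≤ 0.88·L²` (stub (T1) of the line,
proved elsewhere; here it is the antecedent), THEN with `U₃ = 1/500`, for every `U ∈ [0, U₃]` and every
`μ ∈ [-21/25, -7/20]`, `11/20 ≤ liminf_L n_L(U,μ)` and `limsup_L n_L(U,μ) ≤ 19/20`.

Proof (folklore finite-volume inequalities; Koma–Tasaki, J. Stat. Phys. 76 (1994) §1 for the set-up).
* Monotonicity in `μ` at finite volume (`gcNumber_torus_mono`): `N_L(U,-21/25) ≤ N_L(U,μ) ≤ N_L(U,-7/20)`.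
* The finite-volume brackets of the sibling file (`wcbcs_gcNumber_mul_le_levelCount`,
  `wcbcs_levelCount_sub_le_gcNumber_mul`): `2r·torusLevelCount L (μ-r) - U L² ≤ r·N_L(U,μ) ≤
  2r·torusLevelCount L (μ+r) + U L²` for `L ≥ 3`, `0 ≤ U`, `0 < r`.
* Upper: at `μ = -7/20` with `r = 1/20` (`μ + r = -3/10`), `n ≤ 0.88 + 20 U ≤ 0.92 ≤ 19/20` eventually; the
  densities are `≥ 0` (`gcDensity_torus_mem_Icc`), so `limsup ≤ 19/20` (`Filter.limsup_le_of_le`).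
* Lower: at `μ = -21/25` with `r = 2/25` (`μ - r = -23/25`), `n ≥ 0.61 - 12.5 U ≥ 0.585 ≥ 11/20` eventually;
  the densities are `≤ 2`, so `11/20 ≤ liminf` (`Filter.le_liminf_of_le`).

No definition is introduced; the antecedent (T1) is NOT proved here.
-/

-- the summit and the problem are both `HubbardSuperconductivity`, so the namespace legitimately repeats it
set_option linter.dupNamespace false

namespace Summit.HubbardSuperconductivity.HubbardSuperconductivity.Theorems

open Literature.MathematicalPhysics.QuantumLattice Literature.Probability.LatticeModels Matrix Filter Finset
open scoped Topology

/-! ### The registered stub -/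

/-- **Stub (T2) `stub_densityInsideUnitWindow`** of line `ladder-scale-certified-chain` (crux
`WcbcsBcsConstruction`): given the free level counts `0.61·L² ≤ 2·#{ε_L ≤ -23/25}` and
`2·#{ε_L ≤ -3/10} ≤ 0.88·L²` for all large `L` (stub (T1), the antecedent), there is `U₃ > 0` (here `1/500`)
such that for every `U ∈ [0, U₃]` and every `μ ∈ [-21/25, -7/20]` the tracial grand-canonical ground-state
densities of `hubbardTorusWith 2 (L+1) 1 U μ` per `(L+1)²` satisfy `11/20 ≤ liminf_L n_L(U,μ)` and
`limsup_L n_L(U,μ) ≤ 19/20` (monotonicity in `μ` and the finite-volume brackets at steps `r = 2/25`, `1/20`: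
`n_L(U,μ) ≥ 0.61 - 12.5 U` and `n_L(U,μ) ≤ 0.88 + 20 U` eventually). [cite: KomaTasaki1994, §1] -/
theorem stub_densityInsideUnitWindow :
    (∃ L₁ : ℕ, ∀ L : ℕ, L₁ ≤ L → ∀ [NeZero L],
      (61 / 100 : ℝ) * (L : ℝ) ^ 2 ≤ 2 * (torusLevelCount L (-(23:ℝ) / 25) : ℝ) ∧
      2 * (torusLevelCount L (-(3:ℝ) / 10) : ℝ) ≤ (22 / 25 : ℝ) * (L : ℝ) ^ 2) →
    ∃ U₃ : ℝ, 0 < U₃ ∧ ∀ U ∈ Set.Icc (0:ℝ) U₃, ∀ μ ∈ Set.Icc (-(21:ℝ) / 25) (-(7:ℝ) / 20),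
      11 / 20 ≤ liminf (fun L : ℕ => ((hubbardTorusWith 2 (L + 1) 1 U μ).groundStateFunctional
        totalNumber).re / ((L + 1 : ℕ) : ℝ) ^ 2) atTop ∧
      limsup (fun L : ℕ => ((hubbardTorusWith 2 (L + 1) 1 U μ).groundStateFunctional
        totalNumber).re / ((L + 1 : ℕ) : ℝ) ^ 2) atTop ≤ 19 / 20 := by
  rintro ⟨L₁, hL₁⟩
  refine ⟨1 / 500, by norm_num, fun U hU μ hμ => ?_⟩
  obtain ⟨hU0, hU1⟩ := hU
  obtain ⟨hμ0, hμ1⟩ := hμ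
  have hV : ∀ L : ℕ, (0 : ℝ) < ((L + 1 : ℕ) : ℝ) ^ 2 := fun L => by positivity
  have hUV : ∀ L : ℕ, U * ((L + 1 : ℕ) : ℝ) ^ 2 ≤ 1 / 500 * ((L + 1 : ℕ) : ℝ) ^ 2 := fun L =>
    mul_le_mul_of_nonneg_right hU1 (hV L).le
  constructor
  · -- lower: move `μ` down to `-21/25`, then eventually `n_L ≥ 0.61 - 12.5 U ≥ 0.585`; densities are `≤ 2`
    have hev : ∀ᶠ L : ℕ in atTop, 11 / 20 ≤
        ((hubbardTorusWith 2 (L + 1) 1 U μ).groundStateFunctional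
          totalNumber).re / ((L + 1 : ℕ) : ℝ) ^ 2 := by
      refine eventually_atTop.2 ⟨L₁ + 2, fun L hL => ?_⟩
      obtain ⟨hcount, -⟩ := hL₁ (L + 1) (by omega)
      have hbound := wcbcs_levelCount_sub_le_gcNumber_mul (L := L + 1) (by omega) hU0 (-(21:ℝ) / 25)
        (r := 2 / 25) (by norm_num)
      rw [show (-(21:ℝ) / 25 - 2 / 25 : ℝ) = -(23:ℝ) / 25 by norm_num] at hbound
      have hmono := gcNumber_torus_mono (L + 1) 1 U hμ0
      rw [le_div_iff₀ (hV L)]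
      have hUV' := hUV L
      push_cast at hcount hbound hmono hUV' ⊢
      linarith
    exact le_liminf_of_le (isCoboundedUnder_ge_of_le atTop fun L =>
      (gcDensity_torus_mem_Icc (L + 1) 1 U μ).2) hev
  · -- upper: move `μ` up to `-7/20`, then eventually `n_L ≤ 0.88 + 20 U ≤ 0.92`; densities are `≥ 0`
    have hev : ∀ᶠ L : ℕ in atTop, ((hubbardTorusWith 2 (L + 1) 1 U μ).groundStateFunctional
        totalNumber).re / ((L + 1 : ℕ) : ℝ) ^ 2 ≤ 19 / 20 := by
      refine eventually_atTop.2 ⟨L₁ + 2, fun L hL => ?_⟩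
      obtain ⟨-, hcount⟩ := hL₁ (L + 1) (by omega)
      have hbound := wcbcs_gcNumber_mul_le_levelCount (L := L + 1) (by omega) hU0 (-(7:ℝ) / 20)
        (r := 1 / 20) (by norm_num)
      rw [show (-(7:ℝ) / 20 + 1 / 20 : ℝ) = -(3:ℝ) / 10 by norm_num] at hbound
      have hmono := gcNumber_torus_mono (L + 1) 1 U hμ1
      rw [div_le_iff₀ (hV L)]
      have hUV' := hUV L
      push_cast at hcount hbound hmono hUV' ⊢
      linarith
    exact limsup_le_of_le (isCoboundedUnder_le_of_le atTop fun L =>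
      (gcDensity_torus_mem_Icc (L + 1) 1 U μ).1) hev

end Summit.HubbardSuperconductivity.HubbardSuperconductivity.Theorems
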